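import Summits.NavierStokesRegularity.NavierStokesRegularity.Theorems.TypeICertificateLadderTargetStretchingChannelsRung
import Summits.NavierStokesRegularity.NavierStokesRegularity.Theorems.TypeICertificateLadderTargetMostTimesFinalDensity
import Summits.NavierStokesRegularity.NavierStokesRegularity.Theorems.TypeICertificateLadderTargetStretchingLogMean
import HarnessLib

/-!
# Crux `Target` = `TypeICertificateLadder.NoTypeIBlowup` (stmt-NavierStokesRegularity-1217), line
# `depletion-ladder`: THE VORTICITY-SIDE CHANNELS OF ENSTROPHY PRODUCTION, VI — MOST-TIMES form: a Type-I(`C`)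
# blow-up keeps longitudinal palinstrophy fraction `> η²` on a time set of FINAL DENSITY at least
# `(1 − C²η²)/(C²(1 − η²))`

`--supports stmt-NavierStokesRegularity-1217` (helper; file 6 of the channel series, in the most-times language of the
route's deciding crux W3ᵐᵗ stmt-19551: an exceptional time set `E` of final density `θ`, `|E ∩ (T−h,T)| ≤ θh` for small
`h` — VERBATIM the density clause of `AprioriMostTimesBulkAlignment`). Consumer of file III (`longitudinal_along_flow`),
of g8's layer-cake lemma `setLIntegral_inv_sub_le_of_finalDensity` and of g11's LOG-MEAN STRETCHING LAW
`hasSmoothExtensionPast_of_logMean_stretching`. Author: STA lineage `ns-sta-19551-p1` (g12).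

* `intervalIntegral_indicator_inv_sub_le_of_finalDensity` — real-valued form of the layer cake:
  `∫_{t₁}^{t} 𝟙_E(τ) dτ/(T−τ) ≤ θ + θ log(h₀/(T−t))` for `T − h₀ ≤ t₁ < t < T`.
* `hasSmoothExtensionPast_of_mostTimes_longitudinalFraction` — **THE MOST-TIMES LONGITUDINAL RUNG**: rate
  `√(T−t)|u| ≤ C√ν` from `t₁` on, a measurable exceptional set `E` of final density `≤ θ`, and OFF `E` the
  longitudinal palinstrophy fraction `L(t) = (∫‖Dω ω‖²/‖ω‖²)/‖∇ω‖₂² ≤ η²` (`0 ≤ η ≤ 1`); if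
  `C²·(η² + θ(1 − η²)) < 1` the solution extends smoothly past `T` (stretching number `σ = C` on `E`, `σ = Cη` off
  `E`; its log-mean is `≤ C²(η² + θ(1−η²))`).
* `exists_longitudinalFraction_gt_off_exceptional` — **MOST-TIMES PORTRAIT**: at a Type-I(`C`) singular time, for
  every `θ` with `C²(η² + θ(1−η²)) < 1` and every measurable `E` of final density `≤ θ`, after EVERY onset there is a
  time `t ∉ E` with `L(t) > η²` — the set `{L > η²}` is not contained in any set of final density
  `< (1 − C²η²)/(C²(1−η²))` (e.g. `C = 2`, `η² = 1/16`: density `≥ 20 %`; the sup form of file III is `θ = 0`).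

Reading for crux 19551: the crux grants the door an exceptional time set of density `θ < 1`; the enstrophy channel
says that at a Type-I blow-up the GEOMETRIC content (longitudinal slope + curvature, file V) occupies a definite final
density of times, quantified by the rate. WHAT THIS IS NOT: conditional statements; nothing on Type II. [folklore]
-/

noncomputable section

open Set Filter Topology MeasureTheory
open scoped RealInnerProductSpace ENNReal NNReal ContDiff
open Literature.Analysis.FluidPDE

namespace Summit.NavierStokesRegularity.NavierStokesRegularity.Theorems.DepletionLadder

-- the problem directory repeats the summit name (`NavierStokesRegularity/NavierStokesRegularity`)
set_option linter.dupNamespace false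

open Summit.NavierStokesRegularity.NavierStokesRegularity.Theorems.RungReynoldsOne

namespace Channels

/-! ## Real-valued layer cake -/

/-- **Layer cake, real-valued interval form.** For a measurable `E ⊆ ℝ` with `|E ∩ (T−h,T)| ≤ θh` for
`0 < h ≤ h₀` and `T − h₀ ≤ t₁ < t < T`: `∫_{t₁}^{t} 𝟙_E(τ)/(T−τ) dτ ≤ θ + θ log(h₀/(T−t))` (g8's
`setLIntegral_inv_sub_le_of_finalDensity`, transported to the Bochner interval integral). [folklore] -/
theorem intervalIntegral_indicator_inv_sub_le_of_finalDensity {T θ h₀ t₁ t : ℝ} (hθ : 0 ≤ θ) (hh₀ : 0 < h₀)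
    {E : Set ℝ} (hE : MeasurableSet E)
    (hdens : ∀ h : ℝ, 0 < h → h ≤ h₀ → volume (E ∩ Ioo (T - h) T) ≤ ENNReal.ofReal (θ * h))
    (ht₁ : T - h₀ ≤ t₁) (ht : t₁ < t) (htT : t < T) :
    ∫ τ in t₁..t, E.indicator (fun τ => 1 / (T - τ)) τ ≤ θ + θ * Real.log (h₀ / (T - t)) := by
  have hTt : 0 < T - t := sub_pos.2 htT
  have hlog : 0 ≤ Real.log (h₀ / (T - t)) :=
    Real.log_nonneg ((one_le_div hTt).2 (by linarith))
  have hrhs : 0 ≤ θ + θ * Real.log (h₀ / (T - t)) := by positivity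
  -- the lintegral bound on `E ∩ (t₁, t)`
  have hL := setLIntegral_inv_sub_le_of_finalDensity (T := T) hθ hh₀ hE hdens ht₁ ht htT
  -- nonnegativity and measurability of the integrand
  set f : ℝ → ℝ := fun τ => E.indicator (fun τ => 1 / (T - τ)) τ with hfdef
  have hmeas : Measurable f :=
    (measurable_const.div (measurable_const.sub measurable_id)).indicator hE
  have hf0 : ∀ τ, τ < T → 0 ≤ f τ := fun τ hτ => by
    rw [hfdef]; simp only
    by_cases h : τ ∈ E
    · rw [indicator_of_mem h]; exact div_nonneg zero_le_one (sub_pos.2 hτ).le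
    · rw [indicator_of_notMem h]
  -- rewrite the interval integral as a lintegral over `E ∩ (t₁, t]`
  rw [intervalIntegral.integral_of_le ht.le]
  have hnn : 0 ≤ᵐ[volume.restrict (Ioc t₁ t)] f :=
    (ae_restrict_iff' measurableSet_Ioc).2 (Eventually.of_forall fun τ hτ => hf0 τ (hτ.2.trans_lt htT))
  rw [integral_eq_lintegral_of_nonneg_ae hnn hmeas.aestronglyMeasurable]
  refine ENNReal.toReal_le_of_le_ofReal hrhs ?_
  -- `∫⁻_{(t₁,t]} ofReal (𝟙_E/(T−τ)) = ∫⁻_{E ∩ (t₁,t)} ofReal (1/(T−τ))`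
  have hind : ∀ τ, ENNReal.ofReal (f τ) = E.indicator (fun τ => ENNReal.ofReal (1 / (T - τ))) τ := by
    intro τ
    rw [hfdef]; simp only
    by_cases h : τ ∈ E
    · rw [indicator_of_mem h, indicator_of_mem h]
    · rw [indicator_of_notMem h, indicator_of_notMem h, ENNReal.ofReal_zero]
  simp_rw [hind]
  rw [lintegral_indicator hE, Measure.restrict_restrict hE]
  calc ∫⁻ τ in E ∩ Ioc t₁ t, ENNReal.ofReal (1 / (T - τ))
      = ∫⁻ τ in E ∩ Ioo t₁ t, ENNReal.ofReal (1 / (T - τ)) :=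
        setLIntegral_congr ((ae_eq_refl E).inter Ioo_ae_eq_Ioc.symm)
    _ ≤ ENNReal.ofReal (θ + θ * Real.log (h₀ / (T - t))) := hL

/-! ## The most-times longitudinal rung -/

variable {ν T : ℝ} {u : ℝ → EuclideanSpace ℝ (Fin 3) → EuclideanSpace ℝ (Fin 3)}
  {p : ℝ → EuclideanSpace ℝ (Fin 3) → ℝ}

/-- **THE MOST-TIMES LONGITUDINAL RUNG.** Let `u` be a classical Leray–Hopf rapidly-decaying-datum solution on
`ℝ³ × [0,T)` with rate `√(T−t)|u(t,x)| ≤ C√ν` from `t₁` on; let `E` be a measurable set of times of FINAL DENSITY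
`≤ θ` (`|E ∩ (T−h,T)| ≤ θh` for `0 < h < h₀`) off which the longitudinal palinstrophy fraction is small:
`∫‖Dω ω‖²/‖ω‖² ≤ η²‖∇ω‖₂²` for `t ∈ [t₁,T) \ E` (`0 ≤ η ≤ 1`). If `C²(η² + θ(1−η²)) < 1` then `u` extends smoothly
past `T` (log-mean stretching law with `σ = C` on `E`, `σ = Cη` off `E`, and the layer cake). [folklore] -/
theorem hasSmoothExtensionPast_of_mostTimes_longitudinalFraction {t₁ C η θ : ℝ} (hν : 0 < ν) (hT : 0 < T)
    (ht₁ : t₁ ∈ Ico 0 T) (hC : 0 < C) (hη0 : 0 ≤ η) (hη1 : η ≤ 1) (hθ : 0 ≤ θ)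
    (hρ : C ^ 2 * (η ^ 2 + θ * (1 - η ^ 2)) < 1) {E : Set ℝ} (hE : MeasurableSet E)
    (hsol : IsClassicalNSSolutionOn (Ico 0 T) ν 0 u p) (hLH : IsLerayHopfOn T ν 0 (u 0) u)
    (hdec : HasRapidSpatialDecay (u 0))
    (hrate : ∀ t ∈ Ico t₁ T, ∀ x, Real.sqrt (T - t) * ‖u t x‖ ≤ C * Real.sqrt ν)
    (hL : ∀ t ∈ Ico t₁ T, t ∉ E →
      ∫ x, ‖fderiv ℝ (curl (u t)) x (curl (u t) x)‖ ^ 2 / ‖curl (u t) x‖ ^ 2 ≤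
        η ^ 2 * ∫ x, frobeniusNormSq (fderiv ℝ (curl (u t)) x))
    (hdens : ∃ h₀ : ℝ, 0 < h₀ ∧ ∀ h : ℝ, 0 < h → h < h₀ →
      volume (E ∩ Ioo (T - h) T) ≤ ENNReal.ofReal (θ * h)) :
    HasSmoothExtensionPast ν 0 u T := by
  obtain ⟨h₀, hh₀, hd⟩ := hdens
  -- the onset `t₀ = T − h₁`, `h₁ = min (h₀/2) (T − t₁)`
  set h₁ : ℝ := min (h₀ / 2) (T - t₁) with hh₁def
  have hTt₁ : 0 < T - t₁ := sub_pos.2 ht₁.2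
  have hh₁0 : 0 < h₁ := lt_min (by positivity) hTt₁
  have hh₁h₀ : h₁ < h₀ := lt_of_le_of_lt (min_le_left _ _) (by linarith)
  set t₀ : ℝ := T - h₁ with ht₀def
  have ht₁₀ : t₁ ≤ t₀ := by have := min_le_right (h₀ / 2) (T - t₁); rw [ht₀def]; linarith
  have ht₀ : t₀ ∈ Ico 0 T := ⟨ht₁.1.trans ht₁₀, by rw [ht₀def]; linarith⟩
  have hd' : ∀ h : ℝ, 0 < h → h ≤ h₁ → volume (E ∩ Ioo (T - h) T) ≤ ENNReal.ofReal (θ * h) :=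
    fun h hh hle => hd h hh (lt_of_le_of_lt hle hh₁h₀)
  have h1η : 0 ≤ 1 - η ^ 2 := by nlinarith
  -- the stretching-number majorant `σ = C(η + (1−η)𝟙_E)`
  set σ : ℝ → ℝ := fun τ => C * (η + E.indicator (fun _ => (1 : ℝ) - η) τ) with hσdef
  have hσE : ∀ τ, τ ∈ E → σ τ = C := fun τ h => by
    rw [hσdef]; simp only; rw [indicator_of_mem h]; ring
  have hσE' : ∀ τ, τ ∉ E → σ τ = C * η := fun τ h => by
    rw [hσdef]; simp only; rw [indicator_of_notMem h]; ring
  have hσsq : ∀ τ, σ τ ^ 2 / (T - τ) =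
      C ^ 2 * η ^ 2 / (T - τ) + C ^ 2 * (1 - η ^ 2) * E.indicator (fun τ => 1 / (T - τ)) τ := by
    intro τ
    by_cases h : τ ∈ E
    · rw [hσE τ h, indicator_of_mem h]; ring
    · rw [hσE' τ h, indicator_of_notMem h]; ring
  have hfun : (fun τ => σ τ ^ 2 / (T - τ)) =
      fun τ => C ^ 2 * η ^ 2 / (T - τ) + C ^ 2 * (1 - η ^ 2) * E.indicator (fun τ => 1 / (T - τ)) τ :=
    funext hσsq
  -- interval integrability on `[t₀, t]`, `t < T`
  have hmeasI : Measurable fun τ => E.indicator (fun τ => 1 / (T - τ)) τ :=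
    (measurable_const.div (measurable_const.sub measurable_id)).indicator hE
  have hiiI : ∀ t ∈ Ico t₀ T, IntervalIntegrable (fun τ => E.indicator (fun τ => 1 / (T - τ)) τ) volume t₀ t := by
    intro t ht
    have hTt : 0 < T - t := sub_pos.2 ht.2
    rw [intervalIntegrable_iff_integrableOn_Ioc_of_le ht.1]
    refine Measure.integrableOn_of_bounded (M := 1 / (T - t)) measure_Ioc_lt_top.ne
      hmeasI.aestronglyMeasurable ((ae_restrict_iff' measurableSet_Ioc).2 (Eventually.of_forall fun τ hτ => ?_))
    by_cases h : τ ∈ E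
    · rw [indicator_of_mem h, Real.norm_of_nonneg (div_nonneg zero_le_one (by linarith [hτ.2]))]
      exact one_div_le_one_div_of_le hTt (by linarith [hτ.2])
    · rw [indicator_of_notMem h, norm_zero]; positivity
  have hiiC : ∀ t ∈ Ico t₀ T, IntervalIntegrable (fun τ => C ^ 2 * η ^ 2 / (T - τ)) volume t₀ t := by
    intro t ht
    refine (ContinuousOn.div continuousOn_const (continuousOn_const.sub continuousOn_id) fun τ hτ => ?_).intervalIntegrable
    rw [uIcc_of_le ht.1] at hτ
    exact (sub_pos.2 (hτ.2.trans_lt ht.2)).ne'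
  have hii : ∀ t ∈ Ico t₀ T, IntervalIntegrable (fun τ => σ τ ^ 2 / (T - τ)) volume t₀ t := by
    intro t ht
    rw [hfun]
    exact (hiiC t ht).add ((hiiI t ht).const_mul _)
  -- the stretching bound at each late slice
  have hS : ∀ t ∈ Ico t₀ T, ∫ x, ⟪curl (u t) x, fderiv ℝ (u t) x (curl (u t) x)⟫ ≤
      σ t * Real.sqrt (ν / (T - t)) * Real.sqrt (∫ x, ‖curl (u t) x‖ ^ 2) *
        Real.sqrt (∫ x, frobeniusNormSq (fderiv ℝ (curl (u t)) x)) := by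
    intro t ht
    have ht' : t ∈ Ico t₁ T := ⟨ht₁₀.trans ht.1, ht.2⟩
    have ht0T : t ∈ Ico 0 T := ⟨ht₀.1.trans ht.1, ht.2⟩
    have hTt : 0 < T - t := sub_pos.2 ht.2
    have hst : 0 < Real.sqrt (T - t) := Real.sqrt_pos.2 hTt
    -- amplitude `M = C √(ν/(T−t))`
    set M : ℝ := C * Real.sqrt (ν / (T - t)) with hMdef
    have hM : ∀ x, ‖u t x‖ ≤ M := by
      intro x
      have h := hrate t ht' x
      rw [hMdef, Real.sqrt_div hν.le, mul_div_assoc']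
      rw [le_div_iff₀ hst]; linarith
    have hM0 : 0 ≤ M := by positivity
    have hJ := longitudinal_along_flow hν hT hsol hLH hdec t ht0T M hM
    -- `∫‖Dω ω‖²/‖ω‖² ≤ W` always, `≤ η² W` off `E`
    have htt : (t + T) / 2 ∈ Ioo 0 T := ⟨by linarith [ht0T.1], by linarith [ht.2]⟩
    obtain ⟨q, hsolt, hut, -, -⟩ := stub_taoCover hν hT hsol hLH hdec htt
    have htI : t ∈ Icc 0 ((t + T) / 2) := ⟨ht0T.1, by linarith [ht.2]⟩
    obtain ⟨-, iA, -⟩ := slice_integrability hsolt hut htI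
    have hv : ContDiff ℝ ∞ (u t) := hsol.contDiff_velocity ht0T
    obtain ⟨-, hLW⟩ := integral_longitudinalSq_le (v := u t) (hv.of_le (by norm_cast)) iA
    have hW0 : 0 ≤ ∫ x, frobeniusNormSq (fderiv ℝ (curl (u t)) x) :=
      integral_nonneg fun x => frobeniusNormSq_nonneg _
    have hk : Real.sqrt (∫ x, ‖fderiv ℝ (curl (u t)) x (curl (u t) x)‖ ^ 2 / ‖curl (u t) x‖ ^ 2) ≤
        (η + E.indicator (fun _ => (1 : ℝ) - η) t) * Real.sqrt (∫ x, frobeniusNormSq (fderiv ℝ (curl (u t)) x)) := by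
      by_cases h : t ∈ E
      · rw [indicator_of_mem h, show η + (1 - η) = 1 by ring, one_mul]
        exact Real.sqrt_le_sqrt hLW
      · rw [indicator_of_notMem h, add_zero, ← Real.sqrt_sq hη0, ← Real.sqrt_mul (sq_nonneg _)]
        exact Real.sqrt_le_sqrt (hL t ht' h)
    have hk0 : 0 ≤ η + E.indicator (fun _ => (1 : ℝ) - η) t := by
      by_cases h : t ∈ E
      · rw [indicator_of_mem h]; linarith
      · rw [indicator_of_notMem h]; linarith
    calc ∫ x, ⟪curl (u t) x, fderiv ℝ (u t) x (curl (u t) x)⟫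
        ≤ |∫ x, ⟪curl (u t) x, fderiv ℝ (u t) x (curl (u t) x)⟫| := le_abs_self _
      _ ≤ M * Real.sqrt (∫ x, ‖curl (u t) x‖ ^ 2) *
            Real.sqrt (∫ x, ‖fderiv ℝ (curl (u t)) x (curl (u t) x)‖ ^ 2 / ‖curl (u t) x‖ ^ 2) := hJ
      _ ≤ M * Real.sqrt (∫ x, ‖curl (u t) x‖ ^ 2) *
            ((η + E.indicator (fun _ => (1 : ℝ) - η) t) *
              Real.sqrt (∫ x, frobeniusNormSq (fderiv ℝ (curl (u t)) x))) :=
          mul_le_mul_of_nonneg_left hk (by positivity)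
      _ = σ t * Real.sqrt (ν / (T - t)) * Real.sqrt (∫ x, ‖curl (u t) x‖ ^ 2) *
            Real.sqrt (∫ x, frobeniusNormSq (fderiv ℝ (curl (u t)) x)) := by
          rw [hMdef, hσdef]; ring
  -- the log-mean of `σ²`
  set ρ : ℝ := Real.sqrt (C ^ 2 * (η ^ 2 + θ * (1 - η ^ 2))) with hρdef
  have hρsq : ρ ^ 2 = C ^ 2 * (η ^ 2 + θ * (1 - η ^ 2)) := Real.sq_sqrt (by positivity)
  have hρ1 : ρ ^ 2 < 1 := by rw [hρsq]; exact hρ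
  have hmean : ∀ t ∈ Ico t₀ T, ∫ τ in t₀..t, σ τ ^ 2 / (T - τ) ≤
      ρ ^ 2 * Real.log ((T - t₀) / (T - t)) + C ^ 2 * (1 - η ^ 2) * θ := by
    intro t ht
    have hTt : 0 < T - t := sub_pos.2 ht.2
    rcases eq_or_lt_of_le ht.1 with heq | hlt
    · rw [← heq, intervalIntegral.integral_same, div_self (sub_pos.2 ht₀.2).ne', Real.log_one, mul_zero,
        zero_add]
      positivity
    · have hI := intervalIntegral_indicator_inv_sub_le_of_finalDensity hθ hh₁0 hE hd' (le_refl _) hlt ht.2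
      rw [hfun, intervalIntegral.integral_add (hiiC t ht) ((hiiI t ht).const_mul _),
        intervalIntegral.integral_const_mul, integral_const_div_sub ht.1 ht.2, hρsq]
      have hlogeq : Real.log (h₁ / (T - t)) = Real.log ((T - t₀) / (T - t)) := by
        rw [ht₀def]; ring_nf
      rw [hlogeq] at hI
      have hc0 : 0 ≤ C ^ 2 * (1 - η ^ 2) := by positivity
      nlinarith [mul_le_mul_of_nonneg_left hI hc0]
  exact hasSmoothExtensionPast_of_logMean_stretching hν hT hρ1 ht₀ hsol hLH hdec hii hS hmean

/-- **MOST-TIMES PORTRAIT: the longitudinal exceptional set of a Type-I blow-up has positive final density.** If the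
classical Leray–Hopf rapidly-decaying-datum solution has rate `√(T−t)|u| ≤ C√ν` from `t₁` on and does NOT extend
past `T`, then for all `0 ≤ η ≤ 1`, `θ ≥ 0` with `C²(η² + θ(1−η²)) < 1` and every measurable set `E` of final density
`≤ θ`, there is a time `t ∈ [t₁,T) \ E` with `∫‖Dω ω‖²/‖ω‖² > η²‖∇ω‖₂²`: the times of longitudinal palinstrophy
fraction `> η²` are not contained in any set of final density below `(1 − C²η²)/(C²(1−η²))`. [folklore] -/
theorem exists_longitudinalFraction_gt_off_exceptional {t₁ C η θ : ℝ} (hν : 0 < ν) (hT : 0 < T)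
    (ht₁ : t₁ ∈ Ico 0 T) (hC : 0 < C) (hη0 : 0 ≤ η) (hη1 : η ≤ 1) (hθ : 0 ≤ θ)
    (hρ : C ^ 2 * (η ^ 2 + θ * (1 - η ^ 2)) < 1) {E : Set ℝ} (hE : MeasurableSet E)
    (hsol : IsClassicalNSSolutionOn (Ico 0 T) ν 0 u p) (hLH : IsLerayHopfOn T ν 0 (u 0) u)
    (hdec : HasRapidSpatialDecay (u 0))
    (hrate : ∀ t ∈ Ico t₁ T, ∀ x, Real.sqrt (T - t) * ‖u t x‖ ≤ C * Real.sqrt ν)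
    (hdens : ∃ h₀ : ℝ, 0 < h₀ ∧ ∀ h : ℝ, 0 < h → h < h₀ →
      volume (E ∩ Ioo (T - h) T) ≤ ENNReal.ofReal (θ * h))
    (hsing : ¬ HasSmoothExtensionPast ν 0 u T) :
    ∃ t ∈ Ico t₁ T, t ∉ E ∧
      η ^ 2 * ∫ x, frobeniusNormSq (fderiv ℝ (curl (u t)) x) <
        ∫ x, ‖fderiv ℝ (curl (u t)) x (curl (u t) x)‖ ^ 2 / ‖curl (u t) x‖ ^ 2 := by
  by_contra h
  push Not at h
  exact hsing (hasSmoothExtensionPast_of_mostTimes_longitudinalFraction hν hT ht₁ hC hη0 hη1 hθ hρ hE hsol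
    hLH hdec hrate (fun t ht htE => h t ht htE) hdens)


end Channels

end Summit.NavierStokesRegularity.NavierStokesRegularity.Theorems.DepletionLadder

end
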